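import Literature.NumberTheory.Sieve.VinogradovExpSumTools
import Mathlib.NumberTheory.Chebyshev
import HarnessLib

/-!
# Matomäki–Radziwiłł–Tao 2015, §3: the minor arc estimate (bilinear form, `L²` version)

K. Matomäki, M. Radziwiłł, T. Tao, *An averaged form of Chowla's conjecture*, Algebra & Number
Theory **9** (2015), §3 "Proof of minor arc estimate".  Everything in this file is PROVED.

After Ramaré's identity, the minor-arc part of the proof of [MRT2015, Prop. 2.4] reduces to
bounding, for each dyadic block `Ps' ⊆ [2^k, 2^{k+1})` of primes, the bilinear form
`T = ∑_{p ∈ Ps'} ∑_m u(m) c(p) e(α m p) J(mp)`, where `J(n) = ∑_x θ_x 1[x < dn ≤ x + L, dn ≤ N]`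
collects the short windows (`|θ_x|, |u|, |c| ≤ 1`).  The paper applies Hölder with exponent `4`
and an upper-bound sieve for prime quadruples; here we apply **Cauchy–Schwarz** (exponent `2`),
which needs no sieve input at all (only `#Ps' ≤ #[2^k, 2^{k+1})`-type counting and Chebyshev's
bound) and gives, in the regime of [MRT2015, Thm 2.3] with `W = log⁵ H`, a bound that is still
amply sufficient for [MRT2015, Thm 1.7] (see `MatomakiRadziwillTaoKeyEstimate.lean`).  The
ingredients are exactly those of the printed argument otherwise: expansion of the square, the
geometric-series bound `|∑_{m ∈ I} e(βm)| ≤ min(|I|, 1/(2‖β‖))`, the observation that for fixed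
`x` only `O(L)` values of `x'` contribute, and Vinogradov's lemma
`∑_{n ≤ K} min(V, 1/(2‖nα‖)) ≪ (K/q + 1)(V + q log q)` for `|α - a/q| ≤ q⁻²`.

* `Literature.NumberTheory.LFunctions.MRT2015.vinogradov_sum_geomBound_le` — Vinogradov's lemma in the form above (from the
  well-spacing lemmas of `VinogradovExpSumTools.lean`);
* `Literature.NumberTheory.LFunctions.MRT2015.bilinear_block_sq_le` — the `L²` bound for one dyadic block (any finite
  `Ps' ⊆ [2^k, 2^{k+1})`, primality not needed);
* `Literature.NumberTheory.LFunctions.MRT2015.minorArc_bilinear_le` — summed over the dyadic blocks of the primes of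
  `[P_lo, P_hi]` with Chebyshev's bound `#{p ∈ [2^k,2^{k+1})} ≤ 2^{k+3}/(k+1)`:
  `∑_{x ≤ N} |∑_{p} ∑_{m} u(m) c(p) e(αmp) 1[x < dmp ≤ x+L, dmp ≤ N]|
     ≤ 16 N √(L Φ (log₂ P_hi + 1) / d)`,
  `Φ = 10L/(dq) + 10P_hi/q + 8P_hi(1 + log q) + 10L/(d P_lo) + 5 + 4q(1 + log q)`.

## References
* [MRT2015] Matomäki–Radziwiłł–Tao, Algebra & Number Theory 9 (2015), §3 (proof of the minor arc
  case `q > W` of Proposition 2.4: Ramaré's identity (3-2), dyadic decomposition, expansion,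
  "there are only `O(XH³)` quadruples", Vinogradov's lemma). [cite: MatomakiRadziwillTao2015, §3]
* M. B. Nathanson, *Additive Number Theory: the Classical Bases*, GTM 164, §4.4 (Lemmas 4.7–4.10).

## Design choices
* Everything is discrete: `x, n, m, d, L, N` are naturals, windows are `x < dn ≤ x + L`.
* `e(t) = 𝐞 t` is Mathlib's `Real.fourierChar` coerced to `ℂ`; `‖t‖_{ℝ/ℤ}` and
  `min(V, 1/(2‖t‖))` are `Literature.NumberTheory.Sieve.Vinogradov.distInt`, `Literature.NumberTheory.Sieve.Vinogradov.geomBound`.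
-/

noncomputable section

open Finset Real
open scoped Classical FourierTransform

namespace Literature.NumberTheory.LFunctions

namespace MRT2015

open Sieve.Vinogradov

/-! ### Vinogradov's lemma -/

/-- **Vinogradov's lemma** (Nathanson, GTM 164, Lemma 4.10 with constant numerators; the form used
in [MRT2015, §3]): if `|α - a/q| ≤ q⁻²` with `(a, q) = 1`, `q ≥ 1`, then for `V ≥ 0` and every
`K`, `∑_{1 ≤ n ≤ K} min(V, 1/(2‖nα‖)) ≤ (2K/q + 1) (2V + 2q (1 + log q))`.
Proof: split `[1, K]` into blocks of `⌊q/2⌋ + 1` consecutive integers; inside a block the points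
`nα` are pairwise `1/(2q)`-separated modulo `1` (`le_distInt_mul_of_abs_le`), so each block
contributes `≤ 2V + 2q(1 + log q)` (`sum_geomBound_le_of_separated`).
[cite: MatomakiRadziwillTao2015, §3 ("from the Vinogradov lemma")] -/
theorem vinogradov_sum_geomBound_le {α : ℝ} {a : ℤ} {q : ℕ} (hq : 1 ≤ q) (hcop : IsCoprime a q)
    (hα : |α - a / q| ≤ 1 / (q : ℝ) ^ 2) {V : ℝ} (hV : 0 ≤ V) (K : ℕ) :
    ∑ n ∈ Icc 1 K, geomBound V (α * n) ≤
      (2 * K / q + 1) * (2 * V + 2 * q * (1 + Real.log q)) := by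
  have hq0 : (0 : ℝ) < q := by exact_mod_cast hq
  set Lb : ℕ := q / 2 + 1 with hLb
  have hLb1 : 1 ≤ Lb := by omega
  -- number of blocks
  set nb : ℕ := (K - 1) / Lb + 1 with hnb
  have hmaps : ∀ n ∈ Icc 1 K, (n - 1) / Lb ∈ range nb := by
    intro n hn
    rw [Finset.mem_Icc] at hn
    rw [Finset.mem_range, hnb]
    exact Nat.lt_succ_of_le (Nat.div_le_div_right (by omega))
  rw [← Finset.sum_fiberwise_of_maps_to hmaps]
  -- each fibre
  have hδ : (0 : ℝ) < 1 / (2 * q) := by positivity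
  have hfib : ∀ i ∈ range nb,
      ∑ n ∈ (Icc 1 K).filter (fun n => (n - 1) / Lb = i), geomBound V (α * n) ≤
        2 * V + 2 * q * (1 + Real.log q) := by
    intro i _
    have hsep : ∀ n ∈ (Icc 1 K).filter (fun n => (n - 1) / Lb = i),
        ∀ n' ∈ (Icc 1 K).filter (fun n => (n - 1) / Lb = i), n ≠ n' →
          1 / (2 * (q : ℝ)) ≤ distInt (α * n - α * n') := by
      intro n hn n' hn' hne
      rw [Finset.mem_filter, Finset.mem_Icc] at hn hn'
      have hdiff : ((n : ℤ) - (n' : ℤ)).natAbs ≤ q / 2 := by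
        have h1 : (n - 1) / Lb = (n' - 1) / Lb := by rw [hn.2, hn'.2]
        have h2 : (n - 1) % Lb < Lb := Nat.mod_lt _ (by omega)
        have h3 : (n' - 1) % Lb < Lb := Nat.mod_lt _ (by omega)
        have h4 : Lb * ((n - 1) / Lb) + (n - 1) % Lb = n - 1 := Nat.div_add_mod (n - 1) Lb
        have h5 : Lb * ((n - 1) / Lb) + (n' - 1) % Lb = n' - 1 := by
          rw [h1]; exact Nat.div_add_mod (n' - 1) Lb
        generalize Lb * ((n - 1) / Lb) = T at h4 h5
        omega
      have hm0 : ((n : ℤ) - (n' : ℤ)) ≠ 0 := by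
        intro h; apply hne; omega
      have hm : |(((n : ℤ) - (n' : ℤ) : ℤ) : ℝ)| ≤ q / 2 := by
        have h2 : ((((n : ℤ) - (n' : ℤ)).natAbs : ℕ) : ℝ) ≤ (q : ℝ) / 2 :=
          le_trans (by exact_mod_cast hdiff) Nat.cast_div_le
        have h3 : |(((n : ℤ) - (n' : ℤ) : ℤ) : ℝ)| = ((((n : ℤ) - (n' : ℤ)).natAbs : ℕ) : ℝ) := by
          rw [← Int.cast_abs, ← Nat.cast_natAbs]
        rw [h3]; exact h2
      have key := le_distInt_mul_of_abs_le hq hcop hα hm0 hm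
      have e : α * (((n : ℤ) - (n' : ℤ) : ℤ) : ℝ) = α * n - α * n' := by push_cast; ring
      rwa [e] at key
    have h := sum_geomBound_le_of_separated ((Icc 1 K).filter (fun n => (n - 1) / Lb = i))
      (fun n : ℕ => α * n) hδ (m := q) (by
        rw [show (1 : ℝ) / (2 * (1 / (2 * (q : ℝ)))) = q by field_simp]) hsep hV
    calc _ ≤ 2 * V + 1 / (1 / (2 * (q : ℝ))) * (1 + Real.log q) := h
      _ = 2 * V + 2 * q * (1 + Real.log q) := by rw [one_div_one_div]
  calc ∑ i ∈ range nb, ∑ n ∈ (Icc 1 K).filter (fun n => (n - 1) / Lb = i), geomBound V (α * n)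
      ≤ ∑ i ∈ range nb, (2 * V + 2 * q * (1 + Real.log q)) := Finset.sum_le_sum hfib
    _ = nb * (2 * V + 2 * q * (1 + Real.log q)) := by rw [Finset.sum_const, card_range, nsmul_eq_mul]
    _ ≤ (2 * K / q + 1) * (2 * V + 2 * q * (1 + Real.log q)) := by
        have hlog : 0 ≤ 1 + Real.log q := by
          have := Real.log_nonneg (show (1 : ℝ) ≤ q by exact_mod_cast hq); linarith
        refine mul_le_mul_of_nonneg_right ?_ (by positivity)
        -- `nb ≤ (K-1)/Lb + 1 ≤ 2K/q + 1`
        rw [hnb]; push_cast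
        suffices h : (((K - 1) / Lb : ℕ) : ℝ) ≤ 2 * K / q by linarith
        have h1 : (((K - 1) / Lb : ℕ) : ℝ) ≤ ((K - 1 : ℕ) : ℝ) / Lb := Nat.cast_div_le
        refine h1.trans ?_
        have hLbq : (q : ℝ) ≤ 2 * Lb := by
          have : q ≤ 2 * Lb := by omega
          exact_mod_cast this
        have hLb0 : (0 : ℝ) < Lb := by exact_mod_cast hLb1
        have hK1 : ((K - 1 : ℕ) : ℝ) ≤ K := by exact_mod_cast Nat.sub_le K 1
        rw [div_le_div_iff₀ hLb0 hq0]
        nlinarith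

/-- For nonnegative `f`, `∑_{s ∪ t} f ≤ ∑_s f + ∑_t f`. [folklore] -/
theorem sum_union_le_add {ι : Type*} [DecidableEq ι] (s t : Finset ι) {f : ι → ℝ}
    (hf : ∀ i ∈ s ∪ t, 0 ≤ f i) : ∑ i ∈ s ∪ t, f i ≤ ∑ i ∈ s, f i + ∑ i ∈ t, f i := by
  have h := Finset.sum_union_inter (s₁ := s) (s₂ := t) (f := f)
  have h0 : 0 ≤ ∑ i ∈ s ∩ t, f i :=
    Finset.sum_nonneg fun i hi => hf i (Finset.mem_union_left _ (Finset.mem_inter.mp hi).1)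
  linarith

/-- Symmetric form of Vinogradov's lemma: the sum over the integers `0 < |n| ≤ K` is at most twice
the bound, since `min(V, 1/(2‖-t‖)) = min(V, 1/(2‖t‖))`. [cite: MatomakiRadziwillTao2015, §3] -/
theorem vinogradov_sum_geomBound_int_le {α : ℝ} {a : ℤ} {q : ℕ} (hq : 1 ≤ q) (hcop : IsCoprime a q)
    (hα : |α - a / q| ≤ 1 / (q : ℝ) ^ 2) {V : ℝ} (hV : 0 ≤ V) (K : ℕ) :
    ∑ n ∈ (Icc (-(K : ℤ)) K).erase 0, geomBound V (α * n) ≤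
      2 * ((2 * K / q + 1) * (2 * V + 2 * q * (1 + Real.log q))) := by
  have hpos := vinogradov_sum_geomBound_le hq hcop hα hV K
  set A := (Icc (1 : ℕ) K).image (fun n : ℕ => (n : ℤ)) with hA
  set B := (Icc (1 : ℕ) K).image (fun n : ℕ => -(n : ℤ)) with hB
  have hsub : (Icc (-(K : ℤ)) K).erase 0 ⊆ A ∪ B := by
    intro z hz
    simp only [Finset.mem_erase, Finset.mem_Icc] at hz
    rw [Finset.mem_union, hA, hB, Finset.mem_image, Finset.mem_image]
    rcases lt_or_gt_of_ne hz.1 with h | h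
    · right; exact ⟨z.natAbs, Finset.mem_Icc.mpr ⟨by omega, by omega⟩, by omega⟩
    · left; exact ⟨z.natAbs, Finset.mem_Icc.mpr ⟨by omega, by omega⟩, by omega⟩
  have hAsum : ∑ n ∈ A, geomBound V (α * n) = ∑ n ∈ Icc 1 K, geomBound V (α * n) := by
    rw [hA, Finset.sum_image (fun x _ y _ h => by exact_mod_cast h)]
    simp
  have hBsum : ∑ n ∈ B, geomBound V (α * n) = ∑ n ∈ Icc 1 K, geomBound V (α * n) := by
    rw [hB, Finset.sum_image (fun x _ y _ h => by
      have : (x : ℤ) = y := neg_injective h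
      exact_mod_cast this)]
    refine Finset.sum_congr rfl fun n _ => ?_
    push_cast
    rw [mul_neg, geomBound_neg]
  calc ∑ n ∈ (Icc (-(K : ℤ)) K).erase 0, geomBound V (α * n)
      ≤ ∑ n ∈ A ∪ B, geomBound V (α * n) :=
        Finset.sum_le_sum_of_subset_of_nonneg hsub fun n _ _ => geomBound_nonneg hV _
    _ ≤ ∑ n ∈ A, geomBound V (α * n) + ∑ n ∈ B, geomBound V (α * n) :=
        sum_union_le_add A B fun n _ => geomBound_nonneg hV _
    _ ≤ _ := by rw [hAsum, hBsum]; linarith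

/-! ### Windows and the bilinear form -/

/-- The window condition `x < d n ≤ x + L`, `d n ≤ N` of the discretised short sums.
[cite: MatomakiRadziwillTao2015, §3] -/
def WinInd (d L N x n : ℕ) : Prop := x < d * n ∧ d * n ≤ x + L ∧ d * n ≤ N

/-- `J(n) = ∑_{x ≤ N} θ_x 1[x < dn ≤ x + L, dn ≤ N]`, the dual weight attached to `n`.
[cite: MatomakiRadziwillTao2015, §3 (the integrals `∫ θ(x) 1_{x/d ≤ mp ≤ (x+H)/d} dx`)] -/
def Jw (d L N : ℕ) (θ : ℕ → ℂ) (n : ℕ) : ℂ :=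
  ∑ x ∈ range (N + 1), if WinInd d L N x n then θ x else 0

variable {d L N k : ℕ}

/-- The window condition in terms of `m` for `n = m p`: `x/(dp) < m ≤ min((x+L)/(dp), N/(dp))`.
[folklore] -/
theorem winInd_mul_iff {x m p : ℕ} (hdp : 0 < d * p) :
    WinInd d L N x (m * p) ↔ x / (d * p) < m ∧ m ≤ (x + L) / (d * p) ∧ m ≤ N / (d * p) := by
  unfold WinInd
  rw [show d * (m * p) = m * (d * p) by ring, Nat.div_lt_iff_lt_mul hdp,
    Nat.le_div_iff_mul_le hdp, Nat.le_div_iff_mul_le hdp]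

/-- `(x + L)/c ≤ x/c + L/c + 1`. [folklore] -/
theorem add_div_le (x L c : ℕ) : (x + L) / c ≤ x / c + L / c + 1 := by
  rcases Nat.eq_zero_or_pos c with rfl | hc
  · simp
  · rw [Nat.add_div hc]
    split_ifs <;> omega

/-- The set of `m ∈ [1, M]` with `n = mp` in the window of `x` and `n' = mp'` in the window of
`x'` is an interval `(A, B]` of length `≤ L/(dp) + 1`. [cite: MatomakiRadziwillTao2015, §3] -/
theorem filter_winInd_eq_Ioc {x x' p p' M : ℕ} (hdp : 0 < d * p) (hdp' : 0 < d * p') :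
    ∃ A B : ℕ, ((Icc 1 M).filter fun m => WinInd d L N x (m * p) ∧ WinInd d L N x' (m * p')) =
      Ioc A B ∧ B - A ≤ L / (d * p) + 1 := by
  refine ⟨max (x / (d * p)) (x' / (d * p')),
    min (min (min ((x + L) / (d * p)) (N / (d * p))) (min ((x' + L) / (d * p')) (N / (d * p')))) M,
    ?_, ?_⟩
  · ext m
    simp only [Finset.mem_filter, Finset.mem_Icc, winInd_mul_iff hdp, winInd_mul_iff hdp',
      Finset.mem_Ioc, max_lt_iff, le_min_iff]
    generalize x / (d * p) = a₁
    generalize x' / (d * p') = a₂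
    generalize (x + L) / (d * p) = b₁
    generalize (x' + L) / (d * p') = b₂
    generalize N / (d * p) = c₁
    generalize N / (d * p') = c₂
    omega
  · have h1 := add_div_le x L (d * p)
    generalize x / (d * p) = a₁ at h1 ⊢
    generalize x' / (d * p') = a₂
    generalize (x + L) / (d * p) = b₁ at h1 ⊢
    generalize (x' + L) / (d * p') = b₂
    generalize N / (d * p) = c₁
    generalize N / (d * p') = c₂
    generalize L / (d * p) = e at h1 ⊢
    omega

/-- **Only `O(L)` values of `x'` interact with a given `x`** ("the sum vanishes unless
`x_i = x_1 p_i / p_1 + O(H)`", [MRT2015, §3]): for `p, p' ∈ [2^k, 2^{k+1})`, the `x'` for which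
some `m` has `mp` in the window of `x` and `mp'` in the window of `x'` lie in an interval of
length `≤ 3L`. [cite: MatomakiRadziwillTao2015, §3] -/
theorem card_interacting_le {x p p' M : ℕ} (hd : 0 < d) (hp : 2 ^ k ≤ p)
    (hp' : 2 ^ k ≤ p') (hp1' : p' < 2 ^ (k + 1)) :
    #((range (N + 1)).filter fun x' =>
        ((Icc 1 M).filter fun m => WinInd d L N x (m * p) ∧ WinInd d L N x' (m * p')).Nonempty)
      ≤ 3 * L := by
  have hp0 : 0 < p := lt_of_lt_of_le (Nat.two_pow_pos k) hp
  have hp0' : 0 < p' := lt_of_lt_of_le (Nat.two_pow_pos k) hp'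
  have hdp : 0 < d * p := Nat.mul_pos hd hp0
  set m₁ := x / (d * p) + 1 with hm₁
  set m₂ := (x + L) / (d * p) with hm₂
  have hsub : ((range (N + 1)).filter fun x' =>
      ((Icc 1 M).filter fun m => WinInd d L N x (m * p) ∧ WinInd d L N x' (m * p')).Nonempty) ⊆
      Ico (d * m₁ * p' - L) (d * m₂ * p') := by
    intro x' hx'
    rw [Finset.mem_filter] at hx'
    obtain ⟨m, hm⟩ := hx'.2
    rw [Finset.mem_filter] at hm
    obtain ⟨-, hwx, hwx'⟩ := hm
    rw [winInd_mul_iff hdp] at hwx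
    obtain ⟨ha, hb, -⟩ := hwx
    obtain ⟨ha', hb', -⟩ := hwx'
    have hm1 : m₁ ≤ m := by rw [hm₁]; omega
    have hm2 : m ≤ m₂ := hb
    rw [Finset.mem_Ico]
    constructor
    · have : d * m₁ * p' ≤ d * (m * p') := by
        rw [show d * (m * p') = d * m * p' by ring]
        exact Nat.mul_le_mul_right _ (Nat.mul_le_mul_left _ hm1)
      omega
    · have : d * (m * p') ≤ d * m₂ * p' := by
        rw [show d * (m * p') = d * m * p' by ring]
        exact Nat.mul_le_mul_right _ (Nat.mul_le_mul_left _ hm2)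
      omega
  refine (Finset.card_le_card hsub).trans ?_
  rw [Nat.card_Ico]
  -- `d (m₂ - m₁) p' ≤ 2L`
  have hdiff : m₂ ≤ m₁ + L / (d * p) := by
    have := add_div_le x L (d * p)
    rw [hm₂, hm₁]; omega
  have hkey : d * m₂ * p' ≤ d * m₁ * p' + 2 * L := by
    have h1 : d * m₂ * p' ≤ d * (m₁ + L / (d * p)) * p' :=
      Nat.mul_le_mul_right _ (Nat.mul_le_mul_left _ hdiff)
    have h2 : d * (L / (d * p)) ≤ L / p := by
      calc d * (L / (d * p)) ≤ d * L / (d * p) := Nat.mul_div_le_mul_div_assoc _ _ _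
        _ = L / p := Nat.mul_div_mul_left L p hd
    have h3 : L / p * p' ≤ 2 * L := by
      calc L / p * p' ≤ L / p * (2 * p) := Nat.mul_le_mul_left _ (by
            calc p' ≤ 2 ^ (k + 1) := hp1'.le
              _ = 2 * 2 ^ k := by ring
              _ ≤ 2 * p := Nat.mul_le_mul_left _ hp)
        _ = 2 * (L / p * p) := by ring
        _ ≤ 2 * L := Nat.mul_le_mul_left _ (Nat.div_mul_le_self L p)
    have h4 : d * (m₁ + L / (d * p)) * p' = d * m₁ * p' + d * (L / (d * p)) * p' := by ring
    rw [h4] at h1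
    have h5 : d * (L / (d * p)) * p' ≤ L / p * p' := Nat.mul_le_mul_right _ h2
    omega
  omega


/-! ### The character `e(t)` -/

/-- `conj e(t) = e(-t)`. [folklore] -/
theorem conj_fourierChar (t : ℝ) : (starRingEnd ℂ) (𝐞 t : ℂ) = (𝐞 (-t) : ℂ) := by
  rw [Real.fourierChar_apply, Real.fourierChar_apply, ← Complex.exp_conj]
  congr 1
  simp only [map_mul, Complex.conj_ofReal, Complex.conj_I]
  push_cast
  ring

/-- `e(s) e(t) = e(s + t)`. [folklore] -/
theorem fourierChar_mul_fourierChar (s t : ℝ) : (𝐞 s : ℂ) * (𝐞 t : ℂ) = (𝐞 (s + t) : ℂ) := by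
  rw [Real.fourierChar_apply, Real.fourierChar_apply, Real.fourierChar_apply, ← Complex.exp_add]
  congr 1
  push_cast
  ring

/-- `‖e(t)‖ ≤ 1`. [folklore] -/
theorem norm_fourierChar_le_one (t : ℝ) : ‖(𝐞 t : ℂ)‖ ≤ 1 := (norm_fourierChar t).le

/-! ### The `L²` bound for one dyadic block -/

/-- `‖J(n)‖ ≤ L`: at most `L` values of `x` have `x < dn ≤ x + L`. [cite: MatomakiRadziwillTao2015, §3] -/
theorem norm_Jw_le {θ : ℕ → ℂ} (hθ : ∀ x, ‖θ x‖ ≤ 1) (n : ℕ) : ‖Jw d L N θ n‖ ≤ L := by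
  unfold Jw
  rw [← Finset.sum_filter]
  calc ‖∑ x ∈ (range (N + 1)).filter (fun x => WinInd d L N x n), θ x‖
      ≤ ∑ x ∈ (range (N + 1)).filter (fun x => WinInd d L N x n), ‖θ x‖ := norm_sum_le _ _
    _ ≤ ∑ x ∈ (range (N + 1)).filter (fun x => WinInd d L N x n), (1 : ℝ) :=
        Finset.sum_le_sum fun x _ => hθ x
    _ = #((range (N + 1)).filter (fun x => WinInd d L N x n)) := by simp
    _ ≤ #(Ico (d * n - L) (d * n)) := by
        refine Nat.cast_le.mpr (Finset.card_le_card fun x hx => ?_)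
        rw [Finset.mem_filter] at hx
        obtain ⟨h1, h2, -⟩ := hx.2
        rw [Finset.mem_Ico]; omega
    _ ≤ L := by rw [Nat.card_Ico]; exact_mod_cast (by omega : d * n - (d * n - L) ≤ L)

/-- `J(mp) = 0` unless `m ≤ N/(d 2^k)` (for `p ≥ 2^k`). [cite: MatomakiRadziwillTao2015, §3] -/
theorem Jw_mul_eq_zero {θ : ℕ → ℂ} {m p : ℕ} (hd : 0 < d) (hp : 2 ^ k ≤ p)
    (hm : N / (d * 2 ^ k) < m) : Jw d L N θ (m * p) = 0 := by
  unfold Jw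
  refine Finset.sum_eq_zero fun x _ => ?_
  rw [if_neg]
  rintro ⟨-, -, h3⟩
  rw [Nat.div_lt_iff_lt_mul (Nat.mul_pos hd (Nat.two_pow_pos k))] at hm
  have : m * (d * 2 ^ k) ≤ d * (m * p) := by
    calc m * (d * 2 ^ k) = d * (m * 2 ^ k) := by ring
      _ ≤ d * (m * p) := Nat.mul_le_mul_left _ (Nat.mul_le_mul_left _ hp)
  omega

/-- The phase `e(αmp) conj e(αmp') = e(m · α(p - p'))`. [folklore] -/
theorem phase_mul_conj (α : ℝ) (m p p' : ℕ) :
    (𝐞 (α * ((m : ℝ) * p)) : ℂ) * (starRingEnd ℂ) (𝐞 (α * ((m : ℝ) * p')) : ℂ) =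
      (𝐞 ((m : ℝ) * (α * ((p : ℝ) - p'))) : ℂ) := by
  rw [conj_fourierChar, fourierChar_mul_fourierChar]
  congr 1
  ring

/-- The geometric-series bound for the `m`-sum attached to a pair of windows: it is a sum of
`e(mβ)` over an interval of length `≤ L/(d2^k) + 1`. [cite: MatomakiRadziwillTao2015, §3] -/
theorem norm_sum_filter_winInd_le (hd : 0 < d) {x x' p p' M : ℕ} (hp : 2 ^ k ≤ p)
    (hp' : 2 ^ k ≤ p') (β : ℝ) :
    ‖∑ m ∈ (Icc 1 M).filter (fun m => WinInd d L N x (m * p) ∧ WinInd d L N x' (m * p')),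
        (𝐞 ((m : ℝ) * β) : ℂ)‖ ≤ geomBound (L / (d * 2 ^ k : ℝ) + 1) β := by
  have hp0 : 0 < p := lt_of_lt_of_le (Nat.two_pow_pos k) hp
  have hp0' : 0 < p' := lt_of_lt_of_le (Nat.two_pow_pos k) hp'
  obtain ⟨A, B, hF, hlen⟩ := filter_winInd_eq_Ioc (L := L) (N := N) (x := x) (x' := x') (M := M)
    (Nat.mul_pos hd hp0) (Nat.mul_pos hd hp0')
  rw [hF]
  refine norm_sum_Ioc_fourierChar_le_geomBound β ?_
  calc ((B - A : ℕ) : ℝ) ≤ ((L / (d * p) + 1 : ℕ) : ℝ) := by exact_mod_cast hlen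
    _ = ((L / (d * p) : ℕ) : ℝ) + 1 := by push_cast; ring
    _ ≤ (L : ℝ) / ((d * p : ℕ) : ℝ) + 1 := by gcongr; exact Nat.cast_div_le
    _ ≤ L / (d * 2 ^ k : ℝ) + 1 := by
        have h1 : (0 : ℝ) < d * 2 ^ k := by
          have := Nat.mul_pos hd (Nat.two_pow_pos k); exact_mod_cast this
        have h2 : (d * 2 ^ k : ℝ) ≤ ((d * p : ℕ) : ℝ) := by
          push_cast; gcongr; exact_mod_cast hp
        gcongr

/-- **The pair sum** `B(p,p') = ∑_m e(αmp) conj e(αmp') J(mp) conj J(mp')` is at most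
`3L(N+1) min(V, 1/(2‖α(p-p')‖))`: expand `J`, swap the sums, bound the `m`-sum by the geometric
series and count the interacting `x'` (`card_interacting_le`). [cite: MatomakiRadziwillTao2015, §3] -/
theorem norm_pairSum_le (hd : 0 < d) {θ : ℕ → ℂ} (hθ : ∀ x, ‖θ x‖ ≤ 1) {p p' M : ℕ}
    (hp : 2 ^ k ≤ p) (hp' : 2 ^ k ≤ p') (hp1' : p' < 2 ^ (k + 1)) (α : ℝ) :
    ‖∑ m ∈ Icc 1 M, ((𝐞 (α * ((m : ℝ) * p)) : ℂ) * (starRingEnd ℂ) (𝐞 (α * ((m : ℝ) * p')) : ℂ)) *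
        (Jw d L N θ (m * p) * (starRingEnd ℂ) (Jw d L N θ (m * p')))‖ ≤
      3 * L * (N + 1) * geomBound (L / (d * 2 ^ k : ℝ) + 1) (α * ((p : ℝ) - p')) := by
  set β : ℝ := α * ((p : ℝ) - p') with hβ
  set V : ℝ := L / (d * 2 ^ k : ℝ) + 1 with hV
  have hV0 : 0 ≤ V := by positivity
  set F : ℕ → ℕ → Finset ℕ := fun x x' =>
    (Icc 1 M).filter (fun m => WinInd d L N x (m * p) ∧ WinInd d L N x' (m * p')) with hF
  -- rewrite the sum as `∑_x ∑_x' θ_x conj θ_x' ∑_{m ∈ F x x'} e(mβ)`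
  have hrw : ∑ m ∈ Icc 1 M, ((𝐞 (α * ((m : ℝ) * p)) : ℂ) *
      (starRingEnd ℂ) (𝐞 (α * ((m : ℝ) * p')) : ℂ)) *
        (Jw d L N θ (m * p) * (starRingEnd ℂ) (Jw d L N θ (m * p'))) =
      ∑ x ∈ range (N + 1), ∑ x' ∈ range (N + 1),
        θ x * (starRingEnd ℂ) (θ x') * ∑ m ∈ F x x', (𝐞 ((m : ℝ) * β) : ℂ) := by
    have e1 : ∀ m : ℕ, ((𝐞 (α * ((m : ℝ) * p)) : ℂ) *
        (starRingEnd ℂ) (𝐞 (α * ((m : ℝ) * p')) : ℂ)) *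
          (Jw d L N θ (m * p) * (starRingEnd ℂ) (Jw d L N θ (m * p'))) =
        ∑ x ∈ range (N + 1), ∑ x' ∈ range (N + 1),
          if WinInd d L N x (m * p) ∧ WinInd d L N x' (m * p') then
            θ x * (starRingEnd ℂ) (θ x') * (𝐞 ((m : ℝ) * β) : ℂ) else 0 := by
      intro m
      rw [phase_mul_conj, Jw, Jw, map_sum, Finset.sum_mul_sum, Finset.mul_sum]
      refine Finset.sum_congr rfl fun x _ => ?_
      rw [Finset.mul_sum]
      refine Finset.sum_congr rfl fun x' _ => ?_
      by_cases h1 : WinInd d L N x (m * p) <;> by_cases h2 : WinInd d L N x' (m * p') <;>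
        simp [h1, h2, hβ]
      ring
    simp_rw [e1]
    rw [Finset.sum_comm]
    refine Finset.sum_congr rfl fun x _ => ?_
    rw [Finset.sum_comm]
    refine Finset.sum_congr rfl fun x' _ => ?_
    rw [hF]; dsimp only
    rw [Finset.sum_filter, Finset.mul_sum]
    refine Finset.sum_congr rfl fun m _ => ?_
    split_ifs <;> simp
  rw [hrw]
  -- bound
  have hG0 : 0 ≤ geomBound V β := geomBound_nonneg hV0 β
  have hinner : ∀ x ∈ range (N + 1),
      ‖∑ x' ∈ range (N + 1), θ x * (starRingEnd ℂ) (θ x') * ∑ m ∈ F x x', (𝐞 ((m : ℝ) * β) : ℂ)‖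
        ≤ 3 * L * geomBound V β := by
    intro x _
    calc ‖∑ x' ∈ range (N + 1), θ x * (starRingEnd ℂ) (θ x') * ∑ m ∈ F x x', (𝐞 ((m : ℝ) * β) : ℂ)‖
        ≤ ∑ x' ∈ range (N + 1), ‖∑ m ∈ F x x', (𝐞 ((m : ℝ) * β) : ℂ)‖ := by
          refine (norm_sum_le _ _).trans (Finset.sum_le_sum fun x' _ => ?_)
          rw [norm_mul, norm_mul, Complex.norm_conj]
          have h1 : ‖θ x‖ * ‖θ x'‖ ≤ 1 :=
            calc ‖θ x‖ * ‖θ x'‖ ≤ 1 * 1 := mul_le_mul (hθ x) (hθ x') (norm_nonneg _) zero_le_one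
              _ = 1 := one_mul 1
          calc ‖θ x‖ * ‖θ x'‖ * ‖∑ m ∈ F x x', (𝐞 ((m : ℝ) * β) : ℂ)‖
              ≤ 1 * ‖∑ m ∈ F x x', (𝐞 ((m : ℝ) * β) : ℂ)‖ :=
                mul_le_mul_of_nonneg_right h1 (norm_nonneg _)
            _ = _ := one_mul _
      _ = ∑ x' ∈ (range (N + 1)).filter (fun x' => (F x x').Nonempty),
            ‖∑ m ∈ F x x', (𝐞 ((m : ℝ) * β) : ℂ)‖ := by
          rw [Finset.sum_filter]
          refine Finset.sum_congr rfl fun x' _ => ?_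
          split_ifs with h
          · rfl
          · rw [Finset.not_nonempty_iff_eq_empty.mp h, Finset.sum_empty, norm_zero]
      _ ≤ ∑ x' ∈ (range (N + 1)).filter (fun x' => (F x x').Nonempty), geomBound V β := by
          refine Finset.sum_le_sum fun x' _ => ?_
          rw [hF]
          exact norm_sum_filter_winInd_le hd hp hp' β
      _ = #((range (N + 1)).filter (fun x' => (F x x').Nonempty)) * geomBound V β := by
          rw [Finset.sum_const, nsmul_eq_mul]
      _ ≤ (3 * L : ℕ) * geomBound V β := by
          refine mul_le_mul_of_nonneg_right ?_ hG0
          rw [hF]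
          exact_mod_cast card_interacting_le (L := L) (N := N) (x := x) (M := M) hd hp hp' hp1'
      _ = 3 * L * geomBound V β := by push_cast; ring
  calc ‖∑ x ∈ range (N + 1), ∑ x' ∈ range (N + 1),
        θ x * (starRingEnd ℂ) (θ x') * ∑ m ∈ F x x', (𝐞 ((m : ℝ) * β) : ℂ)‖
      ≤ ∑ x ∈ range (N + 1), (3 * L * geomBound V β) :=
        (norm_sum_le _ _).trans (Finset.sum_le_sum hinner)
    _ = 3 * L * (N + 1) * geomBound V β := by
        rw [Finset.sum_const, card_range, nsmul_eq_mul]; push_cast; ring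

/-- For `p ∈ Ps ⊆ [2^k, 2^{k+1})`: `∑_{p' ∈ Ps} min(V, 1/(2‖α(p-p')‖)) ≤ V + (Vinogradov bound over
`0 < |n| ≤ 2^k)`. [cite: MatomakiRadziwillTao2015, §3] -/
theorem sum_geomBound_sub_le (Ps : Finset ℕ) (hPs : ∀ p ∈ Ps, 2 ^ k ≤ p ∧ p < 2 ^ (k + 1))
    {p : ℕ} (hp : p ∈ Ps) {V : ℝ} (hV : 0 ≤ V) (α : ℝ) :
    ∑ p' ∈ Ps, geomBound V (α * ((p : ℝ) - p')) ≤
      V + ∑ n ∈ (Icc (-(2 ^ k : ℕ) : ℤ) (2 ^ k : ℕ)).erase 0, geomBound V (α * n) := by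
  rw [← Finset.add_sum_erase Ps _ hp]
  refine add_le_add (by rw [sub_self, mul_zero, geomBound_zero]) ?_
  have hinj : Set.InjOn (fun p' : ℕ => (p : ℤ) - p') (Ps.erase p : Set ℕ) := by
    intro x _ y _ h
    have : (x : ℤ) = y := by simpa using h
    exact_mod_cast this
  have himg : (Ps.erase p).image (fun p' : ℕ => (p : ℤ) - p') ⊆
      (Icc (-(2 ^ k : ℕ) : ℤ) (2 ^ k : ℕ)).erase 0 := by
    intro z hz
    rw [Finset.mem_image] at hz
    obtain ⟨p', hp', rfl⟩ := hz
    rw [Finset.mem_erase] at hp'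
    have h1 := hPs p hp
    have h2 := hPs p' hp'.2
    rw [Finset.mem_erase, Finset.mem_Icc]
    refine ⟨?_, ?_, ?_⟩
    · have : p' ≠ p := hp'.1
      omega
    · have : (p' : ℤ) < 2 ^ (k + 1) := by exact_mod_cast h2.2
      have : (2 ^ k : ℤ) ≤ p := by exact_mod_cast h1.1
      push_cast
      have e : (2 : ℤ) ^ (k + 1) = 2 * 2 ^ k := by ring
      omega
    · have : (p : ℤ) < 2 ^ (k + 1) := by exact_mod_cast h1.2
      have : (2 ^ k : ℤ) ≤ p' := by exact_mod_cast h2.1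
      push_cast
      have e : (2 : ℤ) ^ (k + 1) = 2 * 2 ^ k := by ring
      omega
  calc ∑ p' ∈ Ps.erase p, geomBound V (α * ((p : ℝ) - p'))
      = ∑ z ∈ (Ps.erase p).image (fun p' : ℕ => (p : ℤ) - p'), geomBound V (α * z) := by
        rw [Finset.sum_image hinj]
        refine Finset.sum_congr rfl fun p' _ => ?_
        push_cast; ring_nf
    _ ≤ _ := Finset.sum_le_sum_of_subset_of_nonneg himg fun z _ _ => geomBound_nonneg hV _

/-- **The `L²` minor-arc bound for one dyadic block** ([MRT2015, §3], with Cauchy–Schwarz in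
place of Hölder): for `Ps' ⊆ [2^k, 2^{k+1})` (any finite set of naturals), `1`-bounded `u, c, θ`,
and `|α - a/q| ≤ q⁻²`, `(a,q) = 1`,
`|∑_{p ∈ Ps'} ∑_m u(m) c(p) e(αmp) J(mp)|² ≤ M' · 3L(N+1) · #Ps' · (V + 2·Vin)`, where
`M' = ⌊N/(d2^k)⌋` bounds the support in `m`, `V = L/(d2^k) + 1` bounds the length of the
`m`-intervals, and `Vin = (2·2^k/q + 1)(2V + 2q(1 + log q))` is Vinogradov's bound.
[cite: MatomakiRadziwillTao2015, §3] -/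
theorem bilinear_block_sq_le (hd : 0 < d) (Ps : Finset ℕ)
    (hPs : ∀ p ∈ Ps, 2 ^ k ≤ p ∧ p < 2 ^ (k + 1)) (u c θ : ℕ → ℂ) (hu : ∀ m, ‖u m‖ ≤ 1)
    (hc : ∀ p, ‖c p‖ ≤ 1) (hθ : ∀ x, ‖θ x‖ ≤ 1) {α : ℝ} {a : ℤ} {q : ℕ} (hq : 1 ≤ q)
    (hcop : IsCoprime a q) (hα : |α - a / q| ≤ 1 / (q : ℝ) ^ 2) :
    ‖∑ p ∈ Ps, ∑ m ∈ Icc 1 N, u m * c p * (𝐞 (α * ((m : ℝ) * p)) : ℂ) * Jw d L N θ (m * p)‖ ^ 2 ≤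
      ((N / (d * 2 ^ k) : ℕ) : ℝ) * (3 * L * (N + 1)) * #Ps *
        ((L / (d * 2 ^ k : ℝ) + 1) + 2 * ((2 * (2 ^ k : ℕ) / q + 1) *
          (2 * (L / (d * 2 ^ k : ℝ) + 1) + 2 * q * (1 + Real.log q)))) := by
  set M' : ℕ := N / (d * 2 ^ k) with hM'
  set V : ℝ := L / (d * 2 ^ k : ℝ) + 1 with hV
  have hV0 : 0 ≤ V := by positivity
  set Vin : ℝ := (2 * (2 ^ k : ℕ) / q + 1) * (2 * V + 2 * q * (1 + Real.log q)) with hVin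
  have hlogq : 0 ≤ 1 + Real.log q := by
    have := Real.log_nonneg (show (1 : ℝ) ≤ q by exact_mod_cast hq); linarith
  have hVin0 : 0 ≤ Vin := by positivity
  -- the window sum as a function of `m`
  set A : ℕ → ℂ := fun m => ∑ p ∈ Ps, c p * (𝐞 (α * ((m : ℝ) * p)) : ℂ) * Jw d L N θ (m * p) with hA
  -- Step 1: support in `m ≤ M'`
  have hT : ∑ p ∈ Ps, ∑ m ∈ Icc 1 N, u m * c p * (𝐞 (α * ((m : ℝ) * p)) : ℂ) * Jw d L N θ (m * p) =
      ∑ m ∈ Icc 1 M', u m * A m := by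
    rw [Finset.sum_comm]
    have e1 : ∀ m, ∑ p ∈ Ps, u m * c p * (𝐞 (α * ((m : ℝ) * p)) : ℂ) * Jw d L N θ (m * p) = u m * A m := by
      intro m
      rw [hA]; dsimp only
      rw [Finset.mul_sum]
      refine Finset.sum_congr rfl fun p _ => by ring
    simp_rw [e1]
    symm
    refine Finset.sum_subset (fun m hm => ?_) (fun m hm hm' => ?_)
    · rw [Finset.mem_Icc] at hm ⊢
      exact ⟨hm.1, hm.2.trans (Nat.div_le_self _ _)⟩
    · rw [Finset.mem_Icc] at hm hm'
      have hmM : M' < m := by omega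
      have : A m = 0 := by
        rw [hA]; dsimp only
        refine Finset.sum_eq_zero fun p hp => ?_
        rw [Jw_mul_eq_zero hd (hPs p hp).1 hmM, mul_zero]
      rw [this, mul_zero]
  rw [hT]
  -- Step 2: Cauchy–Schwarz
  have hCS : ‖∑ m ∈ Icc 1 M', u m * A m‖ ^ 2 ≤ M' * ∑ m ∈ Icc 1 M', ‖A m‖ ^ 2 := by
    have h1 : ‖∑ m ∈ Icc 1 M', u m * A m‖ ≤ ∑ m ∈ Icc 1 M', ‖u m‖ * ‖A m‖ := by
      refine (norm_sum_le _ _).trans (Finset.sum_le_sum fun m _ => ?_)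
      rw [norm_mul]
    have h2 := Real.sum_mul_le_sqrt_mul_sqrt (Icc 1 M') (fun m => ‖u m‖) (fun m => ‖A m‖)
    have h3 : ∑ m ∈ Icc 1 M', ‖u m‖ ^ 2 ≤ M' := by
      calc ∑ m ∈ Icc 1 M', ‖u m‖ ^ 2 ≤ ∑ m ∈ Icc 1 M', (1 : ℝ) := by
            refine Finset.sum_le_sum fun m _ => ?_
            have := hu m
            have h0 := norm_nonneg (u m)
            nlinarith
        _ = M' := by simp
    have h4 : Real.sqrt (∑ m ∈ Icc 1 M', ‖u m‖ ^ 2) ≤ Real.sqrt M' := Real.sqrt_le_sqrt h3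
    have hS0 : 0 ≤ ∑ m ∈ Icc 1 M', ‖A m‖ ^ 2 := Finset.sum_nonneg fun m _ => by positivity
    have h5 : ‖∑ m ∈ Icc 1 M', u m * A m‖ ≤
        Real.sqrt M' * Real.sqrt (∑ m ∈ Icc 1 M', ‖A m‖ ^ 2) :=
      h1.trans (h2.trans (mul_le_mul_of_nonneg_right h4 (Real.sqrt_nonneg _)))
    calc ‖∑ m ∈ Icc 1 M', u m * A m‖ ^ 2
        ≤ (Real.sqrt M' * Real.sqrt (∑ m ∈ Icc 1 M', ‖A m‖ ^ 2)) ^ 2 :=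
          pow_le_pow_left₀ (norm_nonneg _) h5 2
      _ = M' * ∑ m ∈ Icc 1 M', ‖A m‖ ^ 2 := by
          rw [mul_pow, Real.sq_sqrt (by positivity), Real.sq_sqrt hS0]
  refine hCS.trans ?_
  -- Step 3: expand the square
  set B : ℕ → ℕ → ℂ := fun p p' => ∑ m ∈ Icc 1 M',
    ((𝐞 (α * ((m : ℝ) * p)) : ℂ) * (starRingEnd ℂ) (𝐞 (α * ((m : ℝ) * p')) : ℂ)) *
      (Jw d L N θ (m * p) * (starRingEnd ℂ) (Jw d L N θ (m * p'))) with hB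
  have hexp : ∑ m ∈ Icc 1 M', ‖A m‖ ^ 2 ≤ ∑ p ∈ Ps, ∑ p' ∈ Ps, ‖B p p'‖ := by
    have e1 : ∀ m, (‖A m‖ ^ 2 : ℝ) = (A m * (starRingEnd ℂ) (A m)).re := by
      intro m
      rw [Complex.mul_conj, Complex.ofReal_re, Complex.normSq_eq_norm_sq]
    have e2 : ∀ m, A m * (starRingEnd ℂ) (A m) = ∑ p ∈ Ps, ∑ p' ∈ Ps,
        c p * (starRingEnd ℂ) (c p') *
          (((𝐞 (α * ((m : ℝ) * p)) : ℂ) * (starRingEnd ℂ) (𝐞 (α * ((m : ℝ) * p')) : ℂ)) *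
            (Jw d L N θ (m * p) * (starRingEnd ℂ) (Jw d L N θ (m * p')))) := by
      intro m
      rw [hA]; dsimp only
      rw [map_sum, Finset.sum_mul_sum]
      refine Finset.sum_congr rfl fun p _ => Finset.sum_congr rfl fun p' _ => ?_
      simp only [map_mul]
      ring
    have e3 : ∑ m ∈ Icc 1 M', (‖A m‖ ^ 2 : ℝ) =
        (∑ p ∈ Ps, ∑ p' ∈ Ps, c p * (starRingEnd ℂ) (c p') * B p p').re := by
      simp_rw [e1, ← Complex.re_sum, e2]
      congr 1
      rw [Finset.sum_comm]
      refine Finset.sum_congr rfl fun p _ => ?_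
      rw [Finset.sum_comm]
      refine Finset.sum_congr rfl fun p' _ => ?_
      rw [hB]; dsimp only
      rw [Finset.mul_sum]
    rw [e3]
    refine (Complex.re_le_norm _).trans ((norm_sum_le _ _).trans (Finset.sum_le_sum fun p _ =>
      (norm_sum_le _ _).trans (Finset.sum_le_sum fun p' _ => ?_)))
    rw [norm_mul, norm_mul, Complex.norm_conj]
    have h1 : ‖c p‖ * ‖c p'‖ ≤ 1 :=
      calc ‖c p‖ * ‖c p'‖ ≤ 1 * 1 := mul_le_mul (hc p) (hc p') (norm_nonneg _) zero_le_one
        _ = 1 := one_mul 1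
    calc ‖c p‖ * ‖c p'‖ * ‖B p p'‖ ≤ 1 * ‖B p p'‖ :=
          mul_le_mul_of_nonneg_right h1 (norm_nonneg _)
      _ = ‖B p p'‖ := one_mul _
  -- Step 4–5: bound each pair sum and sum over pairs
  have hpair : ∀ p ∈ Ps, ∀ p' ∈ Ps, ‖B p p'‖ ≤ 3 * L * (N + 1) * geomBound V (α * ((p : ℝ) - p')) := by
    intro p hp p' hp'
    rw [hB]
    exact norm_pairSum_le hd hθ (hPs p hp).1 (hPs p' hp').1 (hPs p' hp').2 α
  have hVinK := vinogradov_sum_geomBound_int_le hq hcop hα hV0 (2 ^ k)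
  have hsumG : ∑ p ∈ Ps, ∑ p' ∈ Ps, geomBound V (α * ((p : ℝ) - p')) ≤ #Ps * (V + 2 * Vin) := by
    calc ∑ p ∈ Ps, ∑ p' ∈ Ps, geomBound V (α * ((p : ℝ) - p'))
        ≤ ∑ p ∈ Ps, (V + 2 * Vin) := by
          refine Finset.sum_le_sum fun p hp => ?_
          refine (sum_geomBound_sub_le Ps hPs hp hV0 α).trans ?_
          have : ∑ n ∈ (Icc (-(2 ^ k : ℕ) : ℤ) (2 ^ k : ℕ)).erase 0, geomBound V (α * n) ≤ 2 * Vin := by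
            rw [hVin]; exact_mod_cast hVinK
          linarith
      _ = #Ps * (V + 2 * Vin) := by rw [Finset.sum_const, nsmul_eq_mul]
  have hM'0 : (0 : ℝ) ≤ M' := Nat.cast_nonneg _
  calc (M' : ℝ) * ∑ m ∈ Icc 1 M', ‖A m‖ ^ 2
      ≤ M' * ∑ p ∈ Ps, ∑ p' ∈ Ps, ‖B p p'‖ := mul_le_mul_of_nonneg_left hexp hM'0
    _ ≤ M' * ∑ p ∈ Ps, ∑ p' ∈ Ps, 3 * L * (N + 1) * geomBound V (α * ((p : ℝ) - p')) := by
        refine mul_le_mul_of_nonneg_left ?_ hM'0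
        exact Finset.sum_le_sum fun p hp => Finset.sum_le_sum fun p' hp' => hpair p hp p' hp'
    _ = M' * (3 * L * (N + 1)) * ∑ p ∈ Ps, ∑ p' ∈ Ps, geomBound V (α * ((p : ℝ) - p')) := by
        have e : ∀ p ∈ Ps, ∑ p' ∈ Ps, 3 * (L : ℝ) * (N + 1) * geomBound V (α * ((p : ℝ) - p')) =
            3 * (L : ℝ) * (N + 1) * ∑ p' ∈ Ps, geomBound V (α * ((p : ℝ) - p')) :=
          fun p _ => (Finset.mul_sum _ _ _).symm
        rw [Finset.sum_congr rfl e, ← Finset.mul_sum]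
        ring
    _ ≤ M' * (3 * L * (N + 1)) * (#Ps * (V + 2 * Vin)) :=
        mul_le_mul_of_nonneg_left hsumG (by positivity)
    _ = _ := by rw [hVin, hV]; push_cast; ring

/-! ### Summation over the dyadic blocks of primes -/

/-- Chebyshev: the number of primes in `[2^k, 2^{k+1})` is at most `2^{k+3}/(k+1)`
(`#𝒫_k · k log 2 ≤ θ(2^{k+1}) ≤ (log 4) 2^{k+1}`). [folklore] -/
theorem card_primes_dyadic_le (k : ℕ) :
    (#((Ico (2 ^ k) (2 ^ (k + 1))).filter Nat.Prime) : ℝ) ≤ 2 ^ (k + 3) / (k + 1) := by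
  rcases Nat.eq_zero_or_pos k with rfl | hk
  · have : ((Ico (2 ^ 0) (2 ^ (0 + 1))).filter Nat.Prime) = ∅ := by decide
    rw [this]; norm_num
  set S := (Ico (2 ^ k) (2 ^ (k + 1))).filter Nat.Prime with hS
  have h1 : (#S : ℝ) * (k * Real.log 2) ≤ Real.log 4 * (2 ^ (k + 1) : ℝ) := by
    calc (#S : ℝ) * (k * Real.log 2) = ∑ p ∈ S, (k * Real.log 2) := by
          rw [Finset.sum_const, nsmul_eq_mul]
      _ ≤ ∑ p ∈ S, Real.log p := by
          refine Finset.sum_le_sum fun p hp => ?_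
          rw [hS, Finset.mem_filter, Finset.mem_Ico] at hp
          rw [← Real.log_pow]
          exact Real.log_le_log (by positivity) (by exact_mod_cast hp.1.1)
      _ ≤ ∑ p ∈ Nat.primesLE ⌊((2 ^ (k + 1) : ℕ) : ℝ)⌋₊, Real.log p := by
          rw [Nat.floor_natCast]
          refine Finset.sum_le_sum_of_subset_of_nonneg (fun p hp => ?_) (fun p hp _ => ?_)
          · rw [hS, Finset.mem_filter, Finset.mem_Ico] at hp
            exact Nat.mem_primesLE.mpr ⟨hp.1.2.le, hp.2⟩
          · exact Real.log_nonneg (by exact_mod_cast (Nat.prime_of_mem_primesLE hp).one_lt.le)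
      _ = Chebyshev.theta ((2 ^ (k + 1) : ℕ) : ℝ) := (Chebyshev.theta_eq_sum_primesLE _).symm
      _ ≤ Real.log 4 * ((2 ^ (k + 1) : ℕ) : ℝ) := Chebyshev.theta_le_log4_mul_x (by positivity)
      _ = Real.log 4 * (2 ^ (k + 1) : ℝ) := by push_cast; ring
  have hlog4 : Real.log 4 = 2 * Real.log 2 := by
    rw [show (4 : ℝ) = 2 ^ 2 by norm_num, Real.log_pow]; push_cast; ring
  have hlog2 : 0 < Real.log 2 := Real.log_pos one_lt_two
  have hk1 : (1 : ℝ) ≤ k := by exact_mod_cast hk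
  rw [hlog4] at h1
  -- `#S ≤ 2^{k+2}/k ≤ 2^{k+3}/(k+1)`
  have h2 : (#S : ℝ) * k ≤ 2 ^ (k + 2) := by
    have : (#S : ℝ) * k * Real.log 2 ≤ 2 ^ (k + 2) * Real.log 2 := by
      calc (#S : ℝ) * k * Real.log 2 = (#S : ℝ) * (k * Real.log 2) := by ring
        _ ≤ 2 * Real.log 2 * 2 ^ (k + 1) := h1
        _ = 2 ^ (k + 2) * Real.log 2 := by ring
    exact le_of_mul_le_mul_right this hlog2
  rw [le_div_iff₀ (by positivity)]
  have h3 : (#S : ℝ) * (k + 1) ≤ 2 * ((#S : ℝ) * k) := by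
    have h0 : (0 : ℝ) ≤ #S := Nat.cast_nonneg _
    nlinarith
  calc (#S : ℝ) * (k + 1) ≤ 2 * ((#S : ℝ) * k) := h3
    _ ≤ 2 * 2 ^ (k + 2) := by linarith
    _ = 2 ^ (k + 3) := by ring

/-- `∑_{k ≤ K} 1/√(k+1) ≤ 2√(K+1)`. [folklore] -/
theorem sum_inv_sqrt_le (K : ℕ) :
    ∑ k ∈ range (K + 1), (1 : ℝ) / Real.sqrt (k + 1) ≤ 2 * Real.sqrt (K + 1) := by
  induction K with
  | zero => simp
  | succ K ih =>
    rw [Finset.sum_range_succ]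
    have hK0 : (0 : ℝ) < (K : ℝ) + 1 := by positivity
    have hK1 : (0 : ℝ) < ((K + 1 : ℕ) : ℝ) + 1 := by positivity
    set s := Real.sqrt ((K : ℝ) + 1) with hs
    set t := Real.sqrt (((K + 1 : ℕ) : ℝ) + 1) with ht
    have hs0 : 0 < s := Real.sqrt_pos.mpr hK0
    have ht0 : 0 < t := Real.sqrt_pos.mpr hK1
    have hst : s ≤ t := Real.sqrt_le_sqrt (by push_cast; linarith)
    have hs2 : s ^ 2 = (K : ℝ) + 1 := Real.sq_sqrt hK0.le
    have ht2 : t ^ 2 = ((K + 1 : ℕ) : ℝ) + 1 := Real.sq_sqrt hK1.le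
    -- `1/t ≤ 2 (t - s)` since `(t - s)(t + s) = 1` and `t + s ≤ 2t`
    have key : 1 / t ≤ 2 * (t - s) := by
      have e : (t - s) * (t + s) = 1 := by
        have : t ^ 2 - s ^ 2 = 1 := by rw [hs2, ht2]; push_cast; ring
        nlinarith
      rw [div_le_iff₀ ht0]
      nlinarith
    linarith

/-- The quantity `Φ` collecting the six terms of the dyadic-block bound, uniformly in the block:
`Φ = 10L/(dq) + 10 P_hi/q + 8 P_hi (1 + log q) + 10L/(d P_lo) + 5 + 4q(1 + log q)`.
[cite: MatomakiRadziwillTao2015, §3] -/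
def minorArcPhi (d L q : ℕ) (Plo Phi : ℝ) : ℝ :=
  10 * L / (d * q) + 10 * Phi / q + 8 * Phi * (1 + Real.log q) + 10 * L / (d * Plo) + 5 +
    4 * q * (1 + Real.log q)

/-- `Φ ≥ 0` for `q ≥ 1`, `P_lo, P_hi ≥ 0`. [folklore] -/
theorem minorArcPhi_nonneg {q : ℕ} (hq : 1 ≤ q) {Plo Phi : ℝ} (hPlo : 0 ≤ Plo) (hPhi : 0 ≤ Phi) :
    0 ≤ minorArcPhi d L q Plo Phi := by
  have hlogq : 0 ≤ 1 + Real.log q := by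
    have := Real.log_nonneg (show (1 : ℝ) ≤ q by exact_mod_cast hq); linarith
  unfold minorArcPhi
  positivity

set_option maxHeartbeats 1000000 in
/-- **One dyadic block of primes, simplified bound**: for `𝒫_k = {p ∈ 𝒫 : 2^k ≤ p < 2^{k+1}}`,
`‖T_k‖ ≤ 5 (N+1) √(LΦ/d) / √(k+1)` (from `bilinear_block_sq_le`, Chebyshev's bound
`#𝒫_k ≤ 2^{k+3}/(k+1)`, `⌊N/(d2^k)⌋ #𝒫_k ≤ 8N/(d(k+1))`, and `2^k ≤ P_hi`, `2^k > P_lo/2` for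
non-empty blocks). [cite: MatomakiRadziwillTao2015, §3] -/
theorem block_norm_le (hd : 0 < d) {Plo Phi : ℝ} (hPlo : 2 ≤ Plo)
    (Ps : Finset ℕ) (hPs : ∀ p ∈ Ps, p.Prime ∧ Plo ≤ p ∧ (p : ℝ) ≤ Phi)
    (u c θ : ℕ → ℂ) (hu : ∀ m, ‖u m‖ ≤ 1) (hc : ∀ p, ‖c p‖ ≤ 1) (hθ : ∀ x, ‖θ x‖ ≤ 1)
    {α : ℝ} {a : ℤ} {q : ℕ} (hq : 1 ≤ q) (hcop : IsCoprime a q)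
    (hα : |α - a / q| ≤ 1 / (q : ℝ) ^ 2) (k : ℕ) :
    ‖∑ p ∈ Ps.filter (fun p => Nat.log 2 p = k), ∑ m ∈ Icc 1 N,
        u m * c p * (𝐞 (α * ((m : ℝ) * p)) : ℂ) * Jw d L N θ (m * p)‖ ≤
      5 * (N + 1) * Real.sqrt (L * minorArcPhi d L q Plo Phi / d) * (1 / Real.sqrt (k + 1)) := by
  set Φ := minorArcPhi d L q Plo Phi with hΦdef
  have hPlo0 : 0 < Plo := by linarith
  have hlogq : 0 ≤ 1 + Real.log q := by
    have := Real.log_nonneg (show (1 : ℝ) ≤ q by exact_mod_cast hq); linarith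
  have hd0 : (0 : ℝ) < d := by exact_mod_cast hd
  have hq0 : (0 : ℝ) < q := by exact_mod_cast hq
  set Psk := Ps.filter (fun p => Nat.log 2 p = k) with hPsk
  have hPsk' : ∀ p ∈ Psk, 2 ^ k ≤ p ∧ p < 2 ^ (k + 1) := by
    intro p hp
    rw [hPsk, Finset.mem_filter] at hp
    have hp0 : p ≠ 0 := (hPs p hp.1).1.ne_zero
    rw [← hp.2]
    exact ⟨Nat.pow_log_le_self 2 hp0, Nat.lt_pow_succ_log_self one_lt_two p⟩
  rcases Psk.eq_empty_or_nonempty with hempty | ⟨p₀, hp₀⟩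
  · rw [hempty, Finset.sum_empty, norm_zero]
    positivity
  -- block parameters
  have hp₀' := hPsk' p₀ hp₀
  rw [hPsk, Finset.mem_filter] at hp₀
  have hp₀P := hPs p₀ hp₀.1
  have hPhi0 : 0 ≤ Phi := le_trans (by linarith [hp₀P.2.1]) hp₀P.2.2
  have hΦ0 : 0 ≤ Φ := minorArcPhi_nonneg hq hPlo0.le hPhi0
  have h2k_le : ((2 ^ k : ℕ) : ℝ) ≤ Phi := le_trans (by exact_mod_cast hp₀'.1) hp₀P.2.2
  have hPlo_lt : Plo < 2 * ((2 ^ k : ℕ) : ℝ) := by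
    calc Plo ≤ p₀ := hp₀P.2.1
      _ < ((2 ^ (k + 1) : ℕ) : ℝ) := by exact_mod_cast hp₀'.2
      _ = 2 * ((2 ^ k : ℕ) : ℝ) := by push_cast; ring
  have hsq := bilinear_block_sq_le (L := L) (N := N) hd Psk hPsk' u c θ hu hc hθ hq hcop hα
  -- simplify the right-hand side of the block bound
  set V : ℝ := L / (d * 2 ^ k : ℝ) + 1 with hV
  have hV0 : 0 ≤ V := by positivity
  have hVle : (L : ℝ) / (d * 2 ^ k : ℝ) ≤ 2 * L / (d * Plo) := by
    rw [div_le_div_iff₀ (by positivity) (by positivity)]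
    have h22 : Plo ≤ 2 * (2 : ℝ) ^ k := by push_cast at hPlo_lt; linarith
    have : (L : ℝ) * (d * Plo) ≤ L * (d * (2 * 2 ^ k)) :=
      mul_le_mul_of_nonneg_left (mul_le_mul_of_nonneg_left h22 hd0.le) (Nat.cast_nonneg _)
    nlinarith
  have hcard : (#Psk : ℝ) ≤ 2 ^ (k + 3) / (k + 1) := by
    refine le_trans ?_ (card_primes_dyadic_le k)
    refine Nat.cast_le.mpr (Finset.card_le_card fun p hp => ?_)
    have h1 := hPsk' p hp
    rw [hPsk, Finset.mem_filter] at hp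
    rw [Finset.mem_filter, Finset.mem_Ico]
    exact ⟨h1, (hPs p hp.1).1⟩
  have hM' : (((N / (d * 2 ^ k) : ℕ) : ℝ)) ≤ N / (d * 2 ^ k : ℝ) := by
    have := Nat.cast_div_le (m := N) (n := d * 2 ^ k) (α := ℝ)
    push_cast at this; exact this
  have hMcard : (((N / (d * 2 ^ k) : ℕ) : ℝ)) * #Psk ≤ 8 * N / (d * (k + 1)) := by
    calc (((N / (d * 2 ^ k) : ℕ) : ℝ)) * #Psk ≤ (N / (d * 2 ^ k : ℝ)) * (2 ^ (k + 3) / (k + 1)) :=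
          mul_le_mul hM' hcard (Nat.cast_nonneg _) (by positivity)
      _ = 8 * N / (d * (k + 1)) := by
          have h2 : (2 : ℝ) ^ (k + 3) = 8 * 2 ^ k := by ring
          rw [h2]
          field_simp
  have hbracket : V + 2 * ((2 * (2 ^ k : ℕ) / q + 1) * (2 * V + 2 * q * (1 + Real.log q))) ≤ Φ := by
    have hstep1 : V + 2 * ((2 * (2 ^ k : ℕ) / q + 1) * (2 * V + 2 * q * (1 + Real.log q))) ≤
        (2 * (2 ^ k : ℕ) / q + 1) * (5 * V + 4 * q * (1 + Real.log q)) := by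
      have h0 : (0 : ℝ) ≤ 2 * (2 ^ k : ℕ) / q := by positivity
      nlinarith
    refine hstep1.trans ?_
    have e1 : (2 * (2 ^ k : ℕ) / q + 1) * (5 * V + 4 * q * (1 + Real.log q)) =
        10 * ((2 ^ k : ℕ) : ℝ) * (L / (d * 2 ^ k : ℝ)) / q + 10 * (2 ^ k : ℕ) / q +
          5 * (L / (d * 2 ^ k : ℝ)) + 5 +
          8 * (2 ^ k : ℕ) * (1 + Real.log q) + 4 * q * (1 + Real.log q) := by
      rw [hV]
      field_simp
      ring
    have e2 : 10 * ((2 ^ k : ℕ) : ℝ) * (L / (d * 2 ^ k : ℝ)) / q = 10 * L / (d * q) := by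
      field_simp
      push_cast
      ring
    rw [e1, e2, hΦdef, minorArcPhi]
    have t2 : 10 * ((2 ^ k : ℕ) : ℝ) / q ≤ 10 * Phi / q := by gcongr
    have t3 : 5 * ((L : ℝ) / (d * 2 ^ k : ℝ)) ≤ 10 * L / (d * Plo) := by
      have e3 : 10 * (L : ℝ) / (d * Plo) = 5 * (2 * L / (d * Plo)) := by ring
      rw [e3]; linarith
    have t5 : 8 * ((2 ^ k : ℕ) : ℝ) * (1 + Real.log q) ≤ 8 * Phi * (1 + Real.log q) := by gcongr
    linarith
  -- combine: `‖T_k‖² ≤ 24 L (N+1)² Φ / (d (k+1))`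
  have hsq' : ‖∑ p ∈ Psk, ∑ m ∈ Icc 1 N,
      u m * c p * (𝐞 (α * ((m : ℝ) * p)) : ℂ) * Jw d L N θ (m * p)‖ ^ 2 ≤
      24 * L * (N + 1) ^ 2 * Φ / (d * (k + 1)) := by
    refine hsq.trans ?_
    calc (((N / (d * 2 ^ k) : ℕ) : ℝ)) * (3 * L * (N + 1)) * #Psk *
          (V + 2 * ((2 * (2 ^ k : ℕ) / q + 1) * (2 * V + 2 * q * (1 + Real.log q))))
        = 3 * (L : ℝ) * (N + 1) * ((((N / (d * 2 ^ k) : ℕ) : ℝ)) * #Psk) *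
          (V + 2 * ((2 * (2 ^ k : ℕ) / q + 1) * (2 * V + 2 * q * (1 + Real.log q)))) := by ring
      _ ≤ 3 * (L : ℝ) * (N + 1) * (8 * N / (d * (k + 1))) * Φ := by
          refine mul_le_mul (mul_le_mul_of_nonneg_left hMcard (by positivity)) hbracket
            (by positivity) (by positivity)
      _ = (24 * L * (N + 1) * N * Φ) / (d * (k + 1)) := by ring
      _ ≤ 24 * L * (N + 1) ^ 2 * Φ / (d * (k + 1)) := by
          refine div_le_div_of_nonneg_right ?_ (by positivity)
          have h0 : 0 ≤ 24 * (L : ℝ) * (N + 1) * Φ := by positivity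
          have hN1 : (N : ℝ) ≤ N + 1 := by linarith
          nlinarith
  -- take square roots
  have hnn : 0 ≤ ‖∑ p ∈ Psk, ∑ m ∈ Icc 1 N,
      u m * c p * (𝐞 (α * ((m : ℝ) * p)) : ℂ) * Jw d L N θ (m * p)‖ := norm_nonneg _
  have hRHS0 : 0 ≤ 5 * ((N : ℝ) + 1) * Real.sqrt (L * Φ / d) * (1 / Real.sqrt (k + 1)) := by
    positivity
  have htarget : (5 * ((N : ℝ) + 1) * Real.sqrt (L * Φ / d) * (1 / Real.sqrt (k + 1))) ^ 2 =
      25 * L * (N + 1) ^ 2 * Φ / (d * (k + 1)) := by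
    set s := Real.sqrt (L * Φ / d) with hs
    set t := Real.sqrt ((k : ℝ) + 1) with ht
    have hs2 : s ^ 2 = L * Φ / d := Real.sq_sqrt (by positivity)
    have ht2 : t ^ 2 = (k : ℝ) + 1 := Real.sq_sqrt (by positivity)
    have ht0 : t ≠ 0 := (Real.sqrt_pos.mpr (by positivity)).ne'
    calc (5 * ((N : ℝ) + 1) * s * (1 / t)) ^ 2 = 25 * (N + 1) ^ 2 * s ^ 2 / t ^ 2 := by
          field_simp
          ring
      _ = 25 * (N + 1) ^ 2 * (L * Φ / d) / ((k : ℝ) + 1) := by rw [hs2, ht2]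
      _ = 25 * L * (N + 1) ^ 2 * Φ / (d * (k + 1)) := by
          field_simp
  refine (pow_le_pow_iff_left₀ hnn hRHS0 two_ne_zero).mp ?_
  rw [htarget]
  refine hsq'.trans (div_le_div_of_nonneg_right ?_ (by positivity))
  have : 0 ≤ (L : ℝ) * (N + 1) ^ 2 * Φ := by positivity
  nlinarith

/-- **The minor arc bilinear estimate, summed over dyadic blocks** ([MRT2015, §3], `L²` version):
for primes `𝒫 ⊆ [P_lo, P_hi]`, `1`-bounded `u, c`, `|α - a/q| ≤ q⁻²` with `(a, q) = 1`,
`∑_{x ≤ N} |∑_{p ∈ 𝒫} ∑_{m} u(m) c(p) e(αmp) 1[x < dmp ≤ x + L, dmp ≤ N]|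
   ≤ 10 (N+1) √(L Φ (log₂ P_hi + 1) / d)` with `Φ = minorArcPhi d L q P_lo P_hi`.
Proof: duality in `x`, dyadic decomposition of the primes, `block_norm_le` on each block, and
`∑_k (k+1)^{-1/2} ≤ 2 √(K+1)`. [cite: MatomakiRadziwillTao2015, §3] -/
theorem minorArc_bilinear_le (hd : 0 < d) {Plo Phi : ℝ} (hPlo : 2 ≤ Plo)
    (Ps : Finset ℕ) (hPs : ∀ p ∈ Ps, p.Prime ∧ Plo ≤ p ∧ (p : ℝ) ≤ Phi)
    (u c : ℕ → ℂ) (hu : ∀ m, ‖u m‖ ≤ 1) (hc : ∀ p, ‖c p‖ ≤ 1) {α : ℝ} {a : ℤ} {q : ℕ}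
    (hq : 1 ≤ q) (hcop : IsCoprime a q) (hα : |α - a / q| ≤ 1 / (q : ℝ) ^ 2) :
    ∑ x ∈ range (N + 1), ‖∑ p ∈ Ps, ∑ m ∈ Icc 1 N,
        u m * c p * (𝐞 (α * ((m : ℝ) * p)) : ℂ) * (if WinInd d L N x (m * p) then 1 else 0)‖ ≤
      10 * (N + 1) * Real.sqrt (L * minorArcPhi d L q Plo Phi * (Nat.log 2 ⌊Phi⌋₊ + 1) / d) := by
  set Φ := minorArcPhi d L q Plo Phi with hΦdef
  set K := Nat.log 2 ⌊Phi⌋₊ with hK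
  -- the inner sums and the dual weights
  set S : ℕ → ℂ := fun x => ∑ p ∈ Ps, ∑ m ∈ Icc 1 N,
    u m * c p * (𝐞 (α * ((m : ℝ) * p)) : ℂ) * (if WinInd d L N x (m * p) then 1 else 0) with hSdef
  set θ : ℕ → ℂ := fun x => (starRingEnd ℂ) (S x) / (‖S x‖ : ℂ) with hθdef
  have hθ1 : ∀ x, ‖θ x‖ ≤ 1 := by
    intro x
    rw [hθdef]; dsimp only
    rw [norm_div, Complex.norm_conj, Complex.norm_real, Real.norm_eq_abs, abs_of_nonneg (norm_nonneg _)]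
    exact div_self_le_one _
  have hθS : ∀ x, θ x * S x = (‖S x‖ : ℂ) := by
    intro x
    rw [hθdef]; dsimp only
    by_cases h0 : S x = 0
    · rw [h0]; simp
    · have hn : (‖S x‖ : ℂ) ≠ 0 := by
        rw [Ne, Complex.ofReal_eq_zero, norm_eq_zero]; exact h0
      rw [div_mul_eq_mul_div, div_eq_iff hn, Complex.conj_mul', sq]
  -- duality: `∑_x ‖S x‖ = ∑_x θ_x S_x = ∑_p ∑_m u c e J(mp)`
  have hdual : (∑ x ∈ range (N + 1), ‖S x‖ : ℝ) =
      (∑ p ∈ Ps, ∑ m ∈ Icc 1 N,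
        u m * c p * (𝐞 (α * ((m : ℝ) * p)) : ℂ) * Jw d L N θ (m * p)).re := by
    have e1 : ∑ x ∈ range (N + 1), θ x * S x = ∑ p ∈ Ps, ∑ m ∈ Icc 1 N,
        u m * c p * (𝐞 (α * ((m : ℝ) * p)) : ℂ) * Jw d L N θ (m * p) := by
      simp only [hSdef, Finset.mul_sum]
      rw [Finset.sum_comm]
      refine Finset.sum_congr rfl fun p _ => ?_
      rw [Finset.sum_comm]
      refine Finset.sum_congr rfl fun m _ => ?_
      rw [Jw, Finset.mul_sum]
      refine Finset.sum_congr rfl fun x _ => ?_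
      split_ifs <;> simp
      ring
    rw [← e1]
    simp_rw [hθS]
    rw [Complex.re_sum]
    simp
  rw [hdual]
  refine (Complex.re_le_norm _).trans ?_
  -- dyadic decomposition
  have hmaps : ∀ p ∈ Ps, Nat.log 2 p ∈ range (K + 1) := by
    intro p hp
    rw [Finset.mem_range, Nat.lt_succ_iff, hK]
    exact Nat.log_mono_right (Nat.le_floor (hPs p hp).2.2)
  rw [← Finset.sum_fiberwise_of_maps_to hmaps]
  refine (norm_sum_le _ _).trans ?_
  have hblock : ∀ k ∈ range (K + 1),
      ‖∑ p ∈ Ps.filter (fun p => Nat.log 2 p = k), ∑ m ∈ Icc 1 N,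
          u m * c p * (𝐞 (α * ((m : ℝ) * p)) : ℂ) * Jw d L N θ (m * p)‖ ≤
        5 * (N + 1) * Real.sqrt (L * Φ / d) * (1 / Real.sqrt (k + 1)) :=
    fun k _ => block_norm_le hd hPlo Ps hPs u c θ hu hc hθ1 hq hcop hα k
  have hpos : 0 ≤ 5 * ((N : ℝ) + 1) * Real.sqrt (L * Φ / d) := by positivity
  calc ∑ k ∈ range (K + 1), ‖∑ p ∈ Ps.filter (fun p => Nat.log 2 p = k), ∑ m ∈ Icc 1 N,
          u m * c p * (𝐞 (α * ((m : ℝ) * p)) : ℂ) * Jw d L N θ (m * p)‖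
      ≤ ∑ k ∈ range (K + 1), 5 * (N + 1) * Real.sqrt (L * Φ / d) * (1 / Real.sqrt (k + 1)) :=
        Finset.sum_le_sum hblock
    _ = 5 * (N + 1) * Real.sqrt (L * Φ / d) * ∑ k ∈ range (K + 1), (1 / Real.sqrt (k + 1)) := by
        rw [Finset.mul_sum]
    _ ≤ 5 * (N + 1) * Real.sqrt (L * Φ / d) * (2 * Real.sqrt (K + 1)) :=
        mul_le_mul_of_nonneg_left (sum_inv_sqrt_le K) hpos
    _ = 10 * (N + 1) * (Real.sqrt (L * Φ / d) * Real.sqrt (K + 1)) := by ring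
    _ = 10 * (N + 1) * Real.sqrt (L * Φ * (K + 1) / d) := by
        rw [← Real.sqrt_mul' _ (by positivity)]
        congr 2
        ring

end MRT2015

end Literature.NumberTheory.LFunctions
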